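import Summits.QuantumFields.YangMills.Theorems.BalabanUVNodesN20CoreEdgeLiftedTerm
import Summits.QuantumFields.YangMills.Theorems.BalabanUVNodesSpineReadingOfRecord13CoPH

/-!
# BalabanUVNodes ∕ N20 (NE7b) — the `hedge`-JOINT COMPANION, module 5: N19's core edge AT THE SPINE READING OF RECORD `crOfRecord₁₃` (dag-n20-d, p587226) IS the
# lifted-term sandwich «run A's dressed class weight of `s` vs run B's dressed class weight of `liftSeq s`, minus the shell split» on the small-field-at-old-levels
# histories — module 4 re-keyed at the reading's OWN objects `classSet₁₃ ∕ weightA₁₃ ∕ weightB₁₃ ∕ badClass₁₃`, and fed to n20-d's transfer `core_crOfRecord₁₃At`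

Cell `pub-ymgap` (HUMAN RULING D-0062 Track A; D-0149 width push), seat `pub-ymgap-dag-n20-w3` (WIDTH SEAT 3 of 3 on NODE n20 = NE7b) gen 0; trigger (t2) of this seat's HANDOFF:
dag-n20-d's `Thm/BalabanUVNodesSpineReadingOfRecord13CoPH` LANDED (INBOX l.25163: «REWRITE TARGETS, by name: your generic faces instantiate at `cr := crOfRecord₁₃At K₀ jcut sh` …
★ `core_crOfRecord₁₃At` (n20-w3 ∕ N19′ ∕ U4′)»).  Filed `--kind proof --supports stmt-QuantumFields-20544 --as helper`; COUNT-NEUTRAL.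
[III] = [Balaban1988Convergent], [LF-II] = [Balaban1989LargeFieldII].

WHAT.  The reading of record pins (R3∕R4): index `Σ K, SiteSeqKey F (K₀ + K)`, `l₀ = vol = 1`, runs `runA₁₃ ∕ runB₁₃` with histories `histA₁₃ ∕ histB₁₃`, keys `keyA₁₃`
(= `⟨K, twoRunKeyA …⟩`) ∕ `keyB₁₃` (= `⟨K, twoRunKeyB …⟩` under `0 < θ.τ9.M`, `keyB₁₃_eq`), class set `classSet₁₃ = univ.image keyA₁₃ ∪ univ.image keyB₁₃`, class weights
`weightA₁₃ ∕ weightB₁₃` = the fibre sums of F3's `classWeightOfDatum₉ … (datumOfRecord₁₃CoPH F N θ hP) …`, bad class `badClass₁₃ … jcut = badKeysSigma F (classSet₁₃ … K) jcut`,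
and a DISPLAYED shell split `sh`.  These ARE module 4's binders at `ν := θ.ν`, `M := θ.τ9.M`, `gA := histA₁₃ θ K₀ g₀`, `gB := histB₁₃ θ K₀ g₀`, `a K t := classWeightOfDatum₉ …
(runA₁₃ F K₀ g₀ K) (histA₁₃ …) (K₀ + K) t`, `b K t := … (runB₁₃ …) (histB₁₃ …) (K₀ + K + 1) t`, `shA∕shB := (sh F θ hP g₀ os).1∕.2` — up to (i) the `dite` in `keyB₁₃` and (ii) the
reading's CLASSICAL decidability instances.  This file does the re-keying:
* §1 `classSet₁₃_eq` · `weightA₁₃_eq` · `weightB₁₃_eq` · `badClass₁₃_eq` — the reading's objects ARE B :169's binders at the record's letters (`keyB₁₃_eq`, `Finset.filter_congr`);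
* §2 ★★ `core_reading₁₃_iff_liftedTerm` — `NE7.Core 1 1 (classSet₁₃ θ K₀ g₀) (badClass₁₃ θ K₀ g₀ jcut) (weightA₁₃ − sh.1) (weightB₁₃ − sh.2) δ` (n20-d's `core_crOfRecord₁₃At`'s
  hypothesis `h`, VERBATIM incl. its classical instance) IFF the LIFTED-TERM SANDWICH: for every `K` ONE `c` with, for all `|t| ≤ 1` and every run-A (2.18) sequence `s` of the
  record's run `runA₁₃ F K₀ g₀ K` that is small-field at every level `≤ jcut K`,
  `e^{c − δ K}·(cw_A K t s − sh.1 K t (keyA₁₃ s)) ≤ cw_B K t (liftSeq s) − sh.2 K t (keyA₁₃ s) ≤ e^{c + δ K}·(cw_A K t s − sh.1 K t (keyA₁₃ s))`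
  (`cw_A ∕ cw_B` = F3's dressed class weights of the two runs at the record's datum; policy `1 ≤ jcut K ≤ K₀ + K`; flow hypothesis `hR` on the record's histories DISPLAYED);
* §3 ★★ `core_crOfRecord₁₃At_of_liftedTerm` — that sandwich + `Summable δ` + non-negative run-A cores on the good class (`hP0`, n20-d's displayed letter) ⇒ N19′'s face AT THE
  READING: `NE7.Core` at `crOfRecord₁₃At K₀ jcut sh …`'s own carriers and canonical rate, `∧ Summable` (n20-d's `core_crOfRecord₁₃At` BY NAME).

(α) READING ∕ LOCATED banner: as in modules 2∕4 and in n20-d's header — `badClass₁₃` reads «old AND pending» iff the record's 𝐑-selector `θ.ppSel` is history-rewriting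
((ρ2), the design); under an identity∕junk pin it is «ever created» and `KeyedRelWeight` at it is asymptotically unsatisfiable (evidence #10 on stmt-QuantumFields-20544).
NC-NE7b-α UNRULED.

HONEST FRAMING.  Count-neutral bookkeeping (module 4 + n20-d's reading + transfer BY NAME; nothing re-typed).  It proves NO estimate: the lifted-term sandwich for the record's
dressed class weights IS N19's NE7 core on small-field-at-old-levels histories — NOT PRINTED for `d = 4` ([LF-II] p.356), NOT proved, NAMED OPEN; the shell split `sh` is NODE O's
∕ N21's object (R5), displayed.  A6: LOCATED (§2 is an `iff`).  NE7 ∕ NE7b NOT PRINTED ∕ NOT PROVED; (α)-instance 0∕1; N19 ∕ N20 NOT discharged; K3⁷ NOT closed; counts unmoved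
(typed 28∕28 · discharged 5∕27); no count claim.  One finite `𝕋⁴_{L^K}` programme at fixed `ε = L^{−K}` along two consecutive cutoffs, Bałaban AS PRINTED; the YM mass gap
(Clay) is NOT proved by any of this — R4 closes the conditional finite-𝕋⁴ rung `BalabanLadder.UV` only; NOT ℝ⁴, NOT OS.  No `instance`, no `notation`, no `def`, no `sorry`.
Sources (bookkeeping): [III] (2.1) p.254, (2.18) p.257; [LF-II] Thm 1 + (0.1) pp.355–356, (1.80) p.384; [King1986] (3.10) p.656.
-/

noncomputable section

namespace Summit.QuantumFields.YangMills.BalabanUVNodes.N20CoreEdgeAtReading13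

open Literature.MathematicalPhysics.QuantumFieldTheory.Balaban1983to89 Literature.MathematicalPhysics.QuantumFieldTheory.Balaban1983to89.T4Continuum
open Literature.MathematicalPhysics.QuantumFieldTheory.Balaban1983to89.Node00
open scoped BigOperators
open B14.Eq218Concrete Summit.QuantumFields.BalabanUV.T4Continuum.Spine
open YMDAG.UVSplit
open Summit.QuantumFields.YangMills.BalabanUVNodes.N20CoreEdgeLiftedTerm (core_twoRunKeyed_badKeysSigma_iff_liftedTerm)

variable {F : T4Family} {N : ℕ} [NeZero N]
variable (θ : Stage13HParams F N) (hP : θ.Provisos₁₃CoPH F N) (K₀ : ℕ) (g₀ : ℕ → ℝ) (os : List (ULoop F)) (hM : 0 < θ.τ9.M)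

/-- `NE7.Core` does not depend on the `DecidableEq` instance used for the good-class `sdiff` (instances are subsingletons) — needed because the reading of record carries
`Classical.decEq _` on the σ-key type while the keyed faces carry the instance derived from the per-cutoff ones. [cite: King1986, (3.10) p.656 (bookkeeping)] -/
theorem core_decidableEq_irrel {ι : Type*} (d₁ d₂ : DecidableEq ι) {l₀ vol : ℝ} {T : ℕ → Finset ι} {Bad : ℕ → ℝ → Finset ι} {P Q : ℕ → ℝ → ι → ℝ} {δ : ℕ → ℝ} :
    @NE7.Core ι d₁ l₀ vol T Bad P Q δ ↔ @NE7.Core ι d₂ l₀ vol T Bad P Q δ := by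
  rw [Subsingleton.elim d₁ d₂]

/-! ## §1 The reading's objects ARE B :169's binders at the record's letters -/

/-- Under `0 < θ.τ9.M` the class set of record is B's image union at the record's keys. [cite: Balaban1988Convergent, (2.18) p.257 (bookkeeping)] -/
theorem classSet₁₃_eq (K : ℕ) :
    classSet₁₃ θ K₀ g₀ K =
      (letI : ∀ Kc, DecidableEq (SiteSeqKey F Kc) := fun _ => Classical.decEq _
       Finset.univ.image (fun s : SeqOfRecord F θ.ν θ.τ9.M (histA₁₃ θ K₀ g₀ K) (K₀ + K) (K₀ + K) =>
           (⟨K, twoRunKeyA F θ.ν θ.τ9.M (histA₁₃ θ K₀ g₀ K) (K₀ + K) (K₀ + K) s⟩ : Σ K, SiteSeqKey F (K₀ + K)))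
         ∪ Finset.univ.image (fun s' : SeqOfRecord F θ.ν θ.τ9.M (histB₁₃ θ K₀ g₀ K) (K₀ + K + 1) (K₀ + K + 1) =>
           (⟨K, twoRunKeyB F θ.ν hM (histB₁₃ θ K₀ g₀ K) (K₀ + K) (K₀ + K) s'⟩ : Σ K, SiteSeqKey F (K₀ + K)))) := by
  letI : ∀ Kc, DecidableEq (SiteSeqKey F Kc) := fun _ => Classical.decEq _
  unfold classSet₁₃
  congr 1
  exact Finset.image_congr fun s' _ => keyB₁₃_eq θ K₀ g₀ hM K s'

/-- Run A's class weight of record is B's fibre sum of F3's dressed class weights at the record's datum (definitional). [cite: Balaban1988Convergent, (2.18) p.257 (bookkeeping)] -/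
theorem weightA₁₃_eq (K : ℕ) (t : ℝ) (x : Σ K, SiteSeqKey F (K₀ + K)) :
    weightA₁₃ θ hP K₀ g₀ os K t x =
      (letI : ∀ Kc, DecidableEq (SiteSeqKey F Kc) := fun _ => Classical.decEq _
       ∑ s ∈ Finset.univ.filter (fun s : SeqOfRecord F θ.ν θ.τ9.M (histA₁₃ θ K₀ g₀ K) (K₀ + K) (K₀ + K) =>
           (⟨K, twoRunKeyA F θ.ν θ.τ9.M (histA₁₃ θ K₀ g₀ K) (K₀ + K) (K₀ + K) s⟩ : Σ K, SiteSeqKey F (K₀ + K)) = x),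
         classWeightOfDatum₉ F N θ.toStage9Params (datumOfRecord₁₃CoPH F N θ hP) g₀ os (runA₁₃ F K₀ g₀ K) (histA₁₃ θ K₀ g₀ K) (K₀ + K) t s) :=
  rfl

/-- Under `0 < θ.τ9.M` run B's class weight of record is B's fibre sum over node U5d's block-down fibre. [cite: Balaban1988Convergent, (2.18) p.257 (bookkeeping)] -/
theorem weightB₁₃_eq (K : ℕ) (t : ℝ) (x : Σ K, SiteSeqKey F (K₀ + K)) :
    weightB₁₃ θ hP K₀ g₀ os K t x =
      (letI : ∀ Kc, DecidableEq (SiteSeqKey F Kc) := fun _ => Classical.decEq _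
       ∑ s' ∈ Finset.univ.filter (fun s' : SeqOfRecord F θ.ν θ.τ9.M (histB₁₃ θ K₀ g₀ K) (K₀ + K + 1) (K₀ + K + 1) =>
           (⟨K, twoRunKeyB F θ.ν hM (histB₁₃ θ K₀ g₀ K) (K₀ + K) (K₀ + K) s'⟩ : Σ K, SiteSeqKey F (K₀ + K)) = x),
         classWeightOfDatum₉ F N θ.toStage9Params (datumOfRecord₁₃CoPH F N θ hP) g₀ os (runB₁₃ F K₀ g₀ K) (histB₁₃ θ K₀ g₀ K) (K₀ + K + 1) t s') := by
  letI : ∀ Kc, DecidableEq (SiteSeqKey F Kc) := fun _ => Classical.decEq _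
  unfold weightB₁₃
  refine Finset.sum_congr (Finset.filter_congr fun s' _ => ?_) fun _ _ => rfl
  rw [keyB₁₃_eq θ K₀ g₀ hM K s']

/-- The bad class of record is n20-d's persistence class of the class set (definitional). [cite: Balaban1989LargeFieldII, (1.80) p.384 (bookkeeping)] -/
theorem badClass₁₃_eq (jcut : ℕ → ℕ) (K : ℕ) (t : ℝ) : badClass₁₃ θ K₀ g₀ jcut K t = badKeysSigma F (classSet₁₃ θ K₀ g₀ K) jcut :=
  rfl

/-! ## §2 N19's core edge at the reading's objects ⟺ the lifted-term sandwich at the record's dressed class weights -/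

/-- **★★ AT THE SPINE READING OF RECORD's OBJECTS, N19's CORE EDGE IS THE LIFTED-TERM SANDWICH — LOSS-FREE.**  `NE7.Core 1 1 (classSet₁₃ θ K₀ g₀) (badClass₁₃ θ K₀ g₀ jcut)
(weightA₁₃ − sh.1) (weightB₁₃ − sh.2) δ` — the hypothesis `h` of dag-n20-d's `core_crOfRecord₁₃At`, with ITS classical instance — IFF for every `K` ONE constant `c` such that for all
`|t| ≤ 1` and every run-A (2.18) sequence `s` of `runA₁₃ F K₀ g₀ K` with `s.Λ_j = T_η` for all `1 ≤ j ≤ jcut K`: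
`e^{c − δ K}·(cw_A K t s − sh.1 K t ⟨K, kA s⟩) ≤ cw_B K t (liftSeq s) − sh.2 K t ⟨K, kA s⟩ ≤ e^{c + δ K}·(cw_A K t s − sh.1 K t ⟨K, kA s⟩)`, `cw_A∕cw_B` = F3's dressed class weights
`classWeightOfDatum₉ … (datumOfRecord₁₃CoPH F N θ hP) …` of the two runs (module 4 at the record's letters; `l₀`, `vol` GENERIC — the reading pins them, §3).  DISPLAYED: `hM`, the flow hypothesis `hR` on the record's
histories, the policy letters `1 ≤ jcut K ≤ K₀ + K`, the shell split `sh`.  The right-hand side is N19's NE7 core at the record — NOT PRINTED, NOT proved.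
[cite: King1986, (3.10) p.656; Balaban1989LargeFieldII, Thm 1 + (0.1) pp.355–356, (1.80) p.384; Balaban1988Convergent, (2.1) p.254, (2.18) p.257 (bookkeeping)] -/
theorem core_reading₁₃_iff_liftedTerm (hR : ∀ K, RAgree F θ.ν (histA₁₃ θ K₀ g₀ K) (histB₁₃ θ K₀ g₀ K) (K₀ + K))
    (jcut : ℕ → ℕ) (hj1 : ∀ K, 1 ≤ jcut K) (hjK : ∀ K, jcut K ≤ K₀ + K)
    (sh : (ℕ → ℝ → (Σ K, SiteSeqKey F (K₀ + K)) → ℝ) × (ℕ → ℝ → (Σ K, SiteSeqKey F (K₀ + K)) → ℝ)) (l₀ vol : ℝ) (δ : ℕ → ℝ) :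
    (letI : DecidableEq (Σ K, SiteSeqKey F (K₀ + K)) := Classical.decEq _
     NE7.Core l₀ vol (classSet₁₃ θ K₀ g₀) (badClass₁₃ θ K₀ g₀ jcut) (fun K t x => weightA₁₃ θ hP K₀ g₀ os K t x - sh.1 K t x)
       (fun K t x => weightB₁₃ θ hP K₀ g₀ os K t x - sh.2 K t x) δ)
      ↔ ∀ K : ℕ, ∃ c : ℝ, ∀ t : ℝ, |t| ≤ l₀ → ∀ s : SeqOfRecord F θ.ν θ.τ9.M (histA₁₃ θ K₀ g₀ K) (K₀ + K) (K₀ + K),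
          (∀ j, 1 ≤ j → j ≤ jcut K → s.Λ j = Set.univ) →
          Real.exp (c - vol * δ K) *
                (classWeightOfDatum₉ F N θ.toStage9Params (datumOfRecord₁₃CoPH F N θ hP) g₀ os (runA₁₃ F K₀ g₀ K) (histA₁₃ θ K₀ g₀ K) (K₀ + K) t s
                  - sh.1 K t ⟨K, twoRunKeyA F θ.ν θ.τ9.M (histA₁₃ θ K₀ g₀ K) (K₀ + K) (K₀ + K) s⟩)
              ≤ classWeightOfDatum₉ F N θ.toStage9Params (datumOfRecord₁₃CoPH F N θ hP) g₀ os (runB₁₃ F K₀ g₀ K) (histB₁₃ θ K₀ g₀ K) (K₀ + K + 1) t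
                    (liftSeq F θ.ν hM (hR K) s)
                  - sh.2 K t ⟨K, twoRunKeyA F θ.ν θ.τ9.M (histA₁₃ θ K₀ g₀ K) (K₀ + K) (K₀ + K) s⟩ ∧
            classWeightOfDatum₉ F N θ.toStage9Params (datumOfRecord₁₃CoPH F N θ hP) g₀ os (runB₁₃ F K₀ g₀ K) (histB₁₃ θ K₀ g₀ K) (K₀ + K + 1) t
                    (liftSeq F θ.ν hM (hR K) s)
                  - sh.2 K t ⟨K, twoRunKeyA F θ.ν θ.τ9.M (histA₁₃ θ K₀ g₀ K) (K₀ + K) (K₀ + K) s⟩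
              ≤ Real.exp (c + vol * δ K) *
                (classWeightOfDatum₉ F N θ.toStage9Params (datumOfRecord₁₃CoPH F N θ hP) g₀ os (runA₁₃ F K₀ g₀ K) (histA₁₃ θ K₀ g₀ K) (K₀ + K) t s
                  - sh.1 K t ⟨K, twoRunKeyA F θ.ν θ.τ9.M (histA₁₃ θ K₀ g₀ K) (K₀ + K) (K₀ + K) s⟩) := by
  letI : ∀ Kc, DecidableEq (SiteSeqKey F Kc) := fun _ => Classical.decEq _
  have key := core_twoRunKeyed_badKeysSigma_iff_liftedTerm F θ.ν K₀ hM hR jcut hj1 hjK (l₀ := l₀) (vol := vol)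
    (fun K t s => classWeightOfDatum₉ F N θ.toStage9Params (datumOfRecord₁₃CoPH F N θ hP) g₀ os (runA₁₃ F K₀ g₀ K) (histA₁₃ θ K₀ g₀ K) (K₀ + K) t s)
    (fun K t s' => classWeightOfDatum₉ F N θ.toStage9Params (datumOfRecord₁₃CoPH F N θ hP) g₀ os (runB₁₃ F K₀ g₀ K) (histB₁₃ θ K₀ g₀ K) (K₀ + K + 1) t s')
    sh.1 sh.2 δ
  rw [← key]
  have hT : classSet₁₃ θ K₀ g₀ = fun K =>
      Finset.univ.image (fun s : SeqOfRecord F θ.ν θ.τ9.M (histA₁₃ θ K₀ g₀ K) (K₀ + K) (K₀ + K) =>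
          (⟨K, twoRunKeyA F θ.ν θ.τ9.M (histA₁₃ θ K₀ g₀ K) (K₀ + K) (K₀ + K) s⟩ : Σ K, SiteSeqKey F (K₀ + K)))
        ∪ Finset.univ.image (fun s' : SeqOfRecord F θ.ν θ.τ9.M (histB₁₃ θ K₀ g₀ K) (K₀ + K + 1) (K₀ + K + 1) =>
          (⟨K, twoRunKeyB F θ.ν hM (histB₁₃ θ K₀ g₀ K) (K₀ + K) (K₀ + K) s'⟩ : Σ K, SiteSeqKey F (K₀ + K))) :=
    funext fun K => classSet₁₃_eq θ K₀ g₀ hM K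
  have hBad : badClass₁₃ θ K₀ g₀ jcut = fun K (_ : ℝ) => badKeysSigma F (classSet₁₃ θ K₀ g₀ K) jcut := rfl
  have hA : (fun K t x => weightA₁₃ θ hP K₀ g₀ os K t x - sh.1 K t x) = fun K t x =>
      (∑ s ∈ Finset.univ.filter (fun s : SeqOfRecord F θ.ν θ.τ9.M (histA₁₃ θ K₀ g₀ K) (K₀ + K) (K₀ + K) =>
          (⟨K, twoRunKeyA F θ.ν θ.τ9.M (histA₁₃ θ K₀ g₀ K) (K₀ + K) (K₀ + K) s⟩ : Σ K, SiteSeqKey F (K₀ + K)) = x),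
        classWeightOfDatum₉ F N θ.toStage9Params (datumOfRecord₁₃CoPH F N θ hP) g₀ os (runA₁₃ F K₀ g₀ K) (histA₁₃ θ K₀ g₀ K) (K₀ + K) t s) - sh.1 K t x := by
    funext K t x; rw [weightA₁₃_eq]
  have hB : (fun K t x => weightB₁₃ θ hP K₀ g₀ os K t x - sh.2 K t x) = fun K t x =>
      (∑ s' ∈ Finset.univ.filter (fun s' : SeqOfRecord F θ.ν θ.τ9.M (histB₁₃ θ K₀ g₀ K) (K₀ + K + 1) (K₀ + K + 1) =>
          (⟨K, twoRunKeyB F θ.ν hM (histB₁₃ θ K₀ g₀ K) (K₀ + K) (K₀ + K) s'⟩ : Σ K, SiteSeqKey F (K₀ + K)) = x),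
        classWeightOfDatum₉ F N θ.toStage9Params (datumOfRecord₁₃CoPH F N θ hP) g₀ os (runB₁₃ F K₀ g₀ K) (histB₁₃ θ K₀ g₀ K) (K₀ + K + 1) t s') - sh.2 K t x := by
    funext K t x; rw [weightB₁₃_eq θ hP K₀ g₀ os hM]
  rw [hBad, hA, hB, hT]
  beta_reduce
  -- the two `DecidableEq (Σ K, SiteSeqKey F (K₀ + K))` instances (the reading's `Classical.decEq _` and the one derived from the per-cutoff classical instances) agree
  exact core_decidableEq_irrel _ _

/-! ## §3 The face AT the reading: n20-d's transfer applied -/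

/-- **★★ N19′'s CORE EDGE AT `crOfRecord₁₃At K₀ jcut sh` FROM THE LIFTED-TERM SANDWICH** — DISPLAYED: `hM`, the flow hypothesis `hR` on the record's histories, the policy letters
`1 ≤ jcut K ≤ K₀ + K`, the shell split `sh`, a summable `δ`, NON-NEGATIVE run-A cores on the good class (`hP0`, n20-d's displayed letter — any shell witness supplies it,
`SpineCanonicalWeights.core_nonneg_of_shellWeightBound`), and THE SANDWICH «run A's dressed class weight of `s` vs run B's of `liftSeq s`, minus the shells» on every run-A
sequence that is small-field at every level `≤ jcut K` (N19's NE7 core at the record — NOT PRINTED, NOT proved); CONCLUSION: `NE7.Core` at the reading's own carriers, bad class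
and CANONICAL rate `(crOfRecord₁₃At …).δ`, `∧ Summable` — the core-edge conjunct of K3⁷ v2's stub 2 at the reading of record (dag-n20-d's `core_crOfRecord₁₃At` BY NAME).
[cite: King1986, (3.10) p.656; Balaban1989LargeFieldII, Thm 1 + (0.1) pp.355–356, (1.80) p.384; Balaban1988Convergent, (2.18) p.257 (bookkeeping)] -/
theorem core_crOfRecord₁₃At_of_liftedTerm (hR : ∀ K, RAgree F θ.ν (histA₁₃ θ K₀ g₀ K) (histB₁₃ θ K₀ g₀ K) (K₀ + K))
    (jcut : ℕ → ℕ) (hj1 : ∀ K, 1 ≤ jcut K) (hjK : ∀ K, jcut K ≤ K₀ + K) (sh : ShellSplit₁₃CoPH N K₀) {δ : ℕ → ℝ} (hδ : Summable δ)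
    (hP0 : letI : DecidableEq (Σ K, SiteSeqKey F (K₀ + K)) := Classical.decEq _
      ∀ (K : ℕ) (t : ℝ), |t| ≤ 1 → ∀ x ∈ classSet₁₃ θ K₀ g₀ K \ badClass₁₃ θ K₀ g₀ jcut K t,
        0 ≤ weightA₁₃ θ hP K₀ g₀ os K t x - (sh F θ hP g₀ os).1 K t x)
    (hlift : ∀ K : ℕ, ∃ c : ℝ, ∀ t : ℝ, |t| ≤ 1 → ∀ s : SeqOfRecord F θ.ν θ.τ9.M (histA₁₃ θ K₀ g₀ K) (K₀ + K) (K₀ + K),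
      (∀ j, 1 ≤ j → j ≤ jcut K → s.Λ j = Set.univ) →
      Real.exp (c - 1 * δ K) *
            (classWeightOfDatum₉ F N θ.toStage9Params (datumOfRecord₁₃CoPH F N θ hP) g₀ os (runA₁₃ F K₀ g₀ K) (histA₁₃ θ K₀ g₀ K) (K₀ + K) t s
              - (sh F θ hP g₀ os).1 K t ⟨K, twoRunKeyA F θ.ν θ.τ9.M (histA₁₃ θ K₀ g₀ K) (K₀ + K) (K₀ + K) s⟩)
          ≤ classWeightOfDatum₉ F N θ.toStage9Params (datumOfRecord₁₃CoPH F N θ hP) g₀ os (runB₁₃ F K₀ g₀ K) (histB₁₃ θ K₀ g₀ K) (K₀ + K + 1) t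
                (liftSeq F θ.ν hM (hR K) s)
              - (sh F θ hP g₀ os).2 K t ⟨K, twoRunKeyA F θ.ν θ.τ9.M (histA₁₃ θ K₀ g₀ K) (K₀ + K) (K₀ + K) s⟩ ∧
        classWeightOfDatum₉ F N θ.toStage9Params (datumOfRecord₁₃CoPH F N θ hP) g₀ os (runB₁₃ F K₀ g₀ K) (histB₁₃ θ K₀ g₀ K) (K₀ + K + 1) t
                (liftSeq F θ.ν hM (hR K) s)
              - (sh F θ hP g₀ os).2 K t ⟨K, twoRunKeyA F θ.ν θ.τ9.M (histA₁₃ θ K₀ g₀ K) (K₀ + K) (K₀ + K) s⟩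
          ≤ Real.exp (c + 1 * δ K) *
            (classWeightOfDatum₉ F N θ.toStage9Params (datumOfRecord₁₃CoPH F N θ hP) g₀ os (runA₁₃ F K₀ g₀ K) (histA₁₃ θ K₀ g₀ K) (K₀ + K) t s
              - (sh F θ hP g₀ os).1 K t ⟨K, twoRunKeyA F θ.ν θ.τ9.M (histA₁₃ θ K₀ g₀ K) (K₀ + K) (K₀ + K) s⟩)) :
    (letI := (crOfRecord₁₃At K₀ jcut sh F θ hP g₀ os).dec
     NE7.Core (crOfRecord₁₃At K₀ jcut sh F θ hP g₀ os).l₀ (crOfRecord₁₃At K₀ jcut sh F θ hP g₀ os).vol (crOfRecord₁₃At K₀ jcut sh F θ hP g₀ os).T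
      (crOfRecord₁₃At K₀ jcut sh F θ hP g₀ os).Bad
      (fun K t τ => (crOfRecord₁₃At K₀ jcut sh F θ hP g₀ os).A K t τ - (crOfRecord₁₃At K₀ jcut sh F θ hP g₀ os).shA K t τ)
      (fun K t τ => (crOfRecord₁₃At K₀ jcut sh F θ hP g₀ os).B K t τ - (crOfRecord₁₃At K₀ jcut sh F θ hP g₀ os).shB K t τ)
      (crOfRecord₁₃At K₀ jcut sh F θ hP g₀ os).δ) ∧ Summable (crOfRecord₁₃At K₀ jcut sh F θ hP g₀ os).δ :=
  core_crOfRecord₁₃At K₀ jcut sh θ hP g₀ os hP0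
    ((core_reading₁₃_iff_liftedTerm θ hP K₀ g₀ os hM hR jcut hj1 hjK (sh F θ hP g₀ os) 1 1 δ).2 hlift) hδ

end Summit.QuantumFields.YangMills.BalabanUVNodes.N20CoreEdgeAtReading13

end
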